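import Summits.HodgeConjecture.HodgeConjecture.Theorems.F0P2aCmFrameFactorisation
import HarnessLib

/-!
# FLOOR-0 P2a · B4-ARCHIMEDEAN DESK, line 2 `F0_P2aCohIsotypicLine` — support L2B-ii (`sig_L2Bii`): a function on `U(H)(𝔸_{L⁺})` with
# CONTINUOUS `U(2,1)`-slices, right-`K_c`-invariant and right-invariant under an open `K_f ≤ U(H)(𝔸_{L⁺,f})`, is CONTINUOUS

Cell hodgecm-mathlib (D-0151), FLOOR 0; crux item H413 = stmt-HodgeConjecture-24833 (route `HCCMUnconditional`); line
`Cruxes/H413/Lines/F0_P2aCohIsotypicLine.lean` (F0P2a-plan (g2), sha16 fe64be0a9875628f), S2⁺ `stub_archOrth_hol` CUT of F0P2a-p01 (LEAD)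
`F0/P2a/F0P2a-p01/CUT-S2plus.v1.md`, sub-lemma **L2B-ii** (owner F0P2a-p03): the `W`-package step «arch-smooth ⇒ slice-continuous ⇒ CONTINUOUS»
for the `U(𝔤)`-span of the coordinates of a holomorphic cotangent form (hypotheses `hbd`/`hrep` of ★ `closure_l2OfForms_exp_invariant_of_analytic`).
THEOREMS ONLY (no `def`, no instance, no notation, no named fact, no `sorry`); `--supports stmt-HodgeConjecture-24833`.
HC_CM is proved only modulo the 7 printed citations until rung 0 closes; this file discharges none of them.

## What is proved
For the CM frame `(L, ι, H, T, hT)` (NO definiteness hypothesis is used) and ANY `ψ : U(H)(𝔸_{L⁺}) → X` into a topological space: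
if every `U(2,1)`-slice `u ↦ ψ (x · cmArchSection u)` is continuous, `ψ` is right-invariant under `K_c = cmCompactFactor` and under some OPEN
`K_f ≤ U(H)(𝔸_{L⁺,f})`, then `ψ` is continuous on `U(H)(𝔸_{L⁺})` — `continuous_of_continuous_cmSlice` (generic `X`), and
**`sig_L2Bii_holds`** = p01's `sig_L2Bii` (`X = ℂ`, with the unused definiteness binder) TOKEN FOR TOKEN.
PROOF = the continuity argument of ★ `F0P2aCohFormsContinuous.continuous_of_mem_holCotForms_cm` with the slice continuity as a HYPOTHESIS:
by the frame factorisation ★ `F0P2aCmFrameFactorisation.apply_eq_apply_cmSlice` (`ψ y = ψ ((1, y_f) · cmArchSection (pr_ι y_∞))`) and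
`K_f`-invariance, `ψ` agrees near `x` with the continuous `y ↦ slice_{(1,x_f)} (pr_ι y_∞)` [BorelJacquet1979, §4.1–4.2]; [PlatonovRapinchuk1994, §5.1].

## References
* [BorelJacquet1979] A. Borel, H. Jacquet, Corvallis PSPM 33.1, §4.1–4.2.  [PlatonovRapinchuk1994] V. Platonov, A. Rapinchuk, §5.1.
* Tree: ★ `Theorems/F0P2aCmFrameFactorisation` (frame factorisation, commutations), ★ `Theorems/F0P2aCohFormsContinuous` (the hol-form instance),
  ★ `Automorphic/UnitaryGroupArchProjectionEmb` (`continuous_archProjU21EmbCM`), `UnitaryGroupAdelicProduct` (`continuous_archPart/finPart`).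
-/

set_option autoImplicit false

-- the mandated namespace has the single-problem summit's repeated segment (`HodgeConjecture.HodgeConjecture`)
set_option linter.dupNamespace false

noncomputable section

namespace Summit.HodgeConjecture.HodgeConjecture.Cruxes.H413.F0P2aL2bSliceContinuous

open NumberField NumberField.InfinitePlace Topology Filter
open scoped Matrix ComplexOrder
open Literature.NumberTheory.Automorphic Literature.NumberTheory.Automorphic.UnitaryGroup
open Literature.NumberTheory.Automorphic.UnitaryGroup.CotangentForms (cmArchSection cmCompactFactor)
open Literature.Geometry.ComplexHyperbolic.BallModel (U21)
open Summit.HodgeConjecture.HodgeConjecture.Cruxes.H413.F0P2aCmFrameFactorisation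

variable (L : Type) [Field L] [NumberField L] [IsCMField L] (ι : L →+* ℂ) (H : Matrix (Fin 3) (Fin 3) L) (T : GL (Fin 3) ℂ)
  (hT : (T : Matrix (Fin 3) (Fin 3) ℂ)ᴴ * H.map ι * (T : Matrix (Fin 3) (Fin 3) ℂ) = Literature.Geometry.ComplexHyperbolic.BallModel.J)

/-- **Slice-continuous + right-`K_c`-invariant + right-`K_f`-invariant (open `K_f`) ⇒ CONTINUOUS on `U(H)(𝔸_{L⁺})`** (values in any topological
space; no definiteness hypothesis).  Near `x`, `ψ y = slice_{(1,x_f)} (pr_ι y_∞)` for `y_f ∈ x_f K_f` by the frame factorisation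
`y = (1,y_f) · cmArchSection (pr_ι y_∞) · k`, `k ∈ K_c`, and the commutation `ι_∞(U(2,1)) ↔ U(H)(𝔸_{L⁺,f})`. [cite: BorelJacquet1979, §4.1–4.2]
[cite: PlatonovRapinchuk1994, §5.1] -/
theorem continuous_of_continuous_cmSlice {X : Type*} [TopologicalSpace X]
    (ψ : (adelicGroupData (↥(maximalRealSubfield L)) L (IsCMField.complexConj L) 3 H).Adelic → X)
    (hslice : ∀ x, Continuous fun u : ↥U21 => ψ (x * cmArchSection L ι H T hT u))
    (hK : ∀ k ∈ cmCompactFactor L ι H T hT, ∀ x, ψ (x * k) = ψ x)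
    (hKf : ∃ Kf : Subgroup (finAdelic (↥(maximalRealSubfield L)) L (IsCMField.complexConj L) 3 H),
      IsOpen (Kf : Set (finAdelic (↥(maximalRealSubfield L)) L (IsCMField.complexConj L) 3 H)) ∧
      ∀ k ∈ Kf, ∀ x, ψ (x * finAdelicToAdelic (↥(maximalRealSubfield L)) L (IsCMField.complexConj L) 3 H k) = ψ x) :
    Continuous ψ := by
  obtain ⟨Kf, hKo, hKf⟩ := hKf
  have hP : Continuous fun y : (adelicGroupData (↥(maximalRealSubfield L)) L (IsCMField.complexConj L) 3 H).Adelic =>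
      archProjU21EmbCM L H ι T (formCongr_eq_of_conjTranspose L ι H T hT)
        (archPart (↥(maximalRealSubfield L)) L (IsCMField.complexConj L) 3 H y) :=
    (continuous_archProjU21EmbCM L H ι T _).comp (continuous_archPart (↥(maximalRealSubfield L)) L (IsCMField.complexConj L) 3 H)
  refine continuous_iff_continuousAt.2 fun x => ?_
  -- the continuous candidate near `x`: the slice through `(1, x_f)` composed with `y ↦ pr_ι (y_∞)`
  have hsl := hslice (finAdelicToAdelic (↥(maximalRealSubfield L)) L (IsCMField.complexConj L) 3 H
      (finPart (↥(maximalRealSubfield L)) L (IsCMField.complexConj L) 3 H x))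
  have hN : ∀ᶠ y in 𝓝 x, finPart (↥(maximalRealSubfield L)) L (IsCMField.complexConj L) 3 H (x⁻¹ * y) ∈ Kf := by
    have hc : Continuous fun y : (adelicGroupData (↥(maximalRealSubfield L)) L (IsCMField.complexConj L) 3 H).Adelic =>
        finPart (↥(maximalRealSubfield L)) L (IsCMField.complexConj L) 3 H (x⁻¹ * y) :=
      (continuous_finPart (↥(maximalRealSubfield L)) L (IsCMField.complexConj L) 3 H).comp (continuous_const.mul continuous_id)
    refine hc.continuousAt.eventually_mem (hKo.mem_nhds ?_)
    show finPart (↥(maximalRealSubfield L)) L (IsCMField.complexConj L) 3 H (x⁻¹ * x) ∈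
      (Kf : Set (finAdelic (↥(maximalRealSubfield L)) L (IsCMField.complexConj L) 3 H))
    rw [inv_mul_cancel, map_one]
    exact Kf.one_mem
  have heq : (fun y => ψ (finAdelicToAdelic (↥(maximalRealSubfield L)) L (IsCMField.complexConj L) 3 H
        (finPart (↥(maximalRealSubfield L)) L (IsCMField.complexConj L) 3 H x) *
      cmArchSection L ι H T hT (archProjU21EmbCM L H ι T (formCongr_eq_of_conjTranspose L ι H T hT)
        (archPart (↥(maximalRealSubfield L)) L (IsCMField.complexConj L) 3 H y)))) =ᶠ[𝓝 x] ψ := by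
    filter_upwards [hN] with y hy
    rw [apply_eq_apply_cmSlice L ι H T hT hK y]
    have e : finPart (↥(maximalRealSubfield L)) L (IsCMField.complexConj L) 3 H y =
        finPart (↥(maximalRealSubfield L)) L (IsCMField.complexConj L) 3 H x *
          finPart (↥(maximalRealSubfield L)) L (IsCMField.complexConj L) 3 H (x⁻¹ * y) := by
      rw [← map_mul, mul_inv_cancel_left]
    have e2 : finAdelicToAdelic (↥(maximalRealSubfield L)) L (IsCMField.complexConj L) 3 H
          (finPart (↥(maximalRealSubfield L)) L (IsCMField.complexConj L) 3 H y) *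
        cmArchSection L ι H T hT (archProjU21EmbCM L H ι T (formCongr_eq_of_conjTranspose L ι H T hT)
          (archPart (↥(maximalRealSubfield L)) L (IsCMField.complexConj L) 3 H y)) =
        finAdelicToAdelic (↥(maximalRealSubfield L)) L (IsCMField.complexConj L) 3 H
            (finPart (↥(maximalRealSubfield L)) L (IsCMField.complexConj L) 3 H x) *
          cmArchSection L ι H T hT (archProjU21EmbCM L H ι T (formCongr_eq_of_conjTranspose L ι H T hT)
            (archPart (↥(maximalRealSubfield L)) L (IsCMField.complexConj L) 3 H y)) *
          finAdelicToAdelic (↥(maximalRealSubfield L)) L (IsCMField.complexConj L) 3 H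
            (finPart (↥(maximalRealSubfield L)) L (IsCMField.complexConj L) 3 H (x⁻¹ * y)) := by
      rw [e, map_mul, mul_assoc, mul_assoc, cmArchSection_mul_finAdelicToAdelic]
    rw [e2, hKf _ hy]
  exact (hsl.comp hP).continuousAt.congr heq

/-- **L2B-ii = F0P2a-p01's `sig_L2Bii`, TOKEN FOR TOKEN** (the definiteness binder is carried and not used): for the CM engine frame, a function
`ψ : U(H)(𝔸_{L⁺}) → ℂ` with continuous `U(2,1)`-slices along `cmArchSection`, right-`cmCompactFactor`-invariant and right-invariant under an open
subgroup of `U(H)(𝔸_{L⁺,f})`, is continuous. [cite: BorelJacquet1979, §4.1–4.2] [cite: PlatonovRapinchuk1994, §5.1] -/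
theorem sig_L2Bii_holds :
    ∀ (L : Type) [Field L] [NumberField L] [IsCMField L] (ι : L →+* ℂ) (H : Matrix (Fin 3) (Fin 3) L) (T : GL (Fin 3) ℂ)
      (hT : (T : Matrix (Fin 3) (Fin 3) ℂ)ᴴ * H.map ι * (T : Matrix (Fin 3) (Fin 3) ℂ) = Literature.Geometry.ComplexHyperbolic.BallModel.J),
      (∀ τ' : L →+* ℂ, InfinitePlace.mk τ' ≠ InfinitePlace.mk ι → (H.map τ').PosDef) →
      ∀ ψ : (adelicGroupData (↥(maximalRealSubfield L)) L (IsCMField.complexConj L) 3 H).Adelic → ℂ,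
      (∀ x, Continuous fun u : ↥U21 => ψ (x * cmArchSection L ι H T hT u)) →
      (∀ k ∈ cmCompactFactor L ι H T hT, ∀ x, ψ (x * k) = ψ x) →
      (∃ Kf : Subgroup (finAdelic (↥(maximalRealSubfield L)) L (IsCMField.complexConj L) 3 H),
        IsOpen (Kf : Set (finAdelic (↥(maximalRealSubfield L)) L (IsCMField.complexConj L) 3 H)) ∧
        ∀ k ∈ Kf, ∀ x, ψ (x * finAdelicToAdelic (↥(maximalRealSubfield L)) L (IsCMField.complexConj L) 3 H k) = ψ x) →
      Continuous ψ :=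
  fun L _ _ _ ι H T hT _ ψ hslice hK hKf => continuous_of_continuous_cmSlice L ι H T hT ψ hslice hK hKf

end Summit.HodgeConjecture.HodgeConjecture.Cruxes.H413.F0P2aL2bSliceContinuous

end
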